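import Literature.Computability.AlgebraicComplexity.LampertMoshkovitzDetFourPartitionRank
import Literature.Computability.AlgebraicComplexity.Kum19HomogeneousABPLowerBound
import HarnessLib

/-!
# Gesmundo–Ghosal–Ikenmeyer–Lysikov 2022, §2.3 and §3.1: strength, slice rank and
# degree-restricted strength of a form; the ABP lower bound `B_hom(F) ≥ Σ_j str_j(F)`

Topic `Literature/Computability/AlgebraicComplexity` (one file for the section group §2.3 + §3.1, D-0064).
Source: F. Gesmundo, P. Ghosal, C. Ikenmeyer, V. Lysikov, *Degree-restricted strength decompositions
and algebraic branching programs*, FSTTCS 2022 (LIPIcs 250, 20), arXiv:2205.02149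
[GesmundoGhosalIkenmeyerLysikov2022]; read as the held text `paper:arxiv-2205.02149` (pages
`p0004`–`p0006`).  Verbatim:

* (p0004 L47–L52) "**2.3 Strength and slice rank of polynomial.** ▶ **Definition 5.** Let `F` be a
  homogeneous polynomial of degree `d`. A strength decomposition of `F` is a decomposition of the form
  `F = Σ_{k=1}^r G_k H_k` where `G_k` and `H_k` are homogeneous polynomials of degree less than `d`.
  The strength of `F` is `str(F) = min{r : F has a strength decomposition with r summands}`."
* (p0005 L31–L38) "▶ **Definition 8.** Let `F` be a homogeneous polynomial of degree `d`. A slice rank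
  decomposition of `F` is a decomposition of the form `F = Σ_{k=1}^r L_k H_k` where `L_k` are linear
  forms. The minimal number of summands in a strength decomposition of `F` [of this form] is called the
  slice rank of `F` and is denoted by `sr(F)`."
* (p0006 L1–L11) "▶ **Definition 10.** Let `F` be a homogeneous polynomial of degree `d`. A strength
  decomposition `F = Σ_{k=1}^r G_k H_k` is called `j`-restricted if `deg G_k = j` for all `k`. The
  `j`-restricted strength `str_j(F)` is the minimal number of summands in a `j`-restricted strength
  decomposition of `F`.  The following basic properties are clear from the definition.
  ▶ **Proposition 11.** Let `F` be a homogeneous polynomial of degree `d` and let `j` be an integer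
  such that `1 ≤ j < d`. The following statements hold. (a) `str_j(F) ≥ str(F)`;
  (b) `str_j(F) = str_{d−j}(F)`; (c) `str_1(F) = sr(F)`."
* (p0006 L12–L26) "▶ **Theorem 12.** For every homogeneous polynomial `F` of degree `d`,
  `B_hom(F) ≥ Σ_{j=1}^{d−1} str_j(F)`.  Proof. Let `A` be a homogeneous ABP computing `F` with source
  `s` and sink `t`. … Let `V_j` be the set of vertices in the `j`-th layer. Since each path from the
  source to the sink contains exactly one vertex from each layer, we have
  `F = A[s,t] = Σ_{v ∈ V_j} A[s,v] A[v,t]`. If `v` lies in the `j`-th layer then `deg A[s,v] = j` …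
  Thus `F` has a `j`-restricted strength decomposition with `|V_j|` summands, showing
  `|V_j| ≥ str_j(F)`. Summing over all layers, we obtain the desired lower bound."

## What is typed (definitions with bodies; all statements PROVED; no named fact)

Over a commutative (semi)ring `K` and any variable type `σ`, with the degree `d` of the form carried
explicitly (GGIL fix "`F` homogeneous of degree `d`" throughout; for `F = 0` or when no decomposition
exists the minima below are `0` by the convention `sInf ∅ = 0` — immaterial under the homogeneity
hypotheses of the source, see `hasRestrictedDecomp_card_support`):
* `GGIL22.HasStrengthDecomp d r F`, `GGIL22.strength d F` — Definition 5;
* `GGIL22.HasRestrictedDecomp d j r F` (`F = Σ_{k<r} G_k H_k`, `G_k` homogeneous of degree `j`, `H_k`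
  homogeneous of degree `d − j`), `GGIL22.restrictedStrength d j F = str_j(F)` — Definition 10;
* `GGIL22.sliceRank d F := restrictedStrength d 1 F` — Definition 8 (a slice rank decomposition IS a
  `1`-restricted strength decomposition, so Prop. 11(c) is definitional, as the source says; the
  variant with arbitrary cofactors `H_k` is equivalent for homogeneous `F`:
  `hasRestrictedDecomp_of_eq_sum_mul`, `sliceRank_le_of_eq_sum_linear_mul`).  NOT the slice rank of
  `3`-tensors `Literature.Barriers.MatrixMultiplication.sliceRank` / the slice-rank method of
  `Literature/Combinatorics/Additive/SliceRankMethod.lean` (GGIL p0005 L39–L40: "related but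
  geometrically very different").
* Proposition 11 (a)(b)(c): `strength_le_restrictedStrength`, `restrictedStrength_symm`,
  `sliceRank_eq_restrictedStrength_one` — PROVED; plus the existence / attainment API
  (`hasRestrictedDecomp_card_support`: every form of degree `d ≥ j` has the monomial `j`-restricted
  decomposition, so `str_j(F) ≤ #supp F`; `exists_hasRestrictedDecomp_restrictedStrength`).
* Theorem 12 for the tree's LAYERED homogeneous ABPs (`Kumar2019.HomLayeredABPComputes`, file
  `Kum19HomogeneousABPLowerBound.lean` — GGIL's `B_hom` model is the layered homogeneous one, every
  edge raising the degree by one): `sum_restrictedStrength_le_of_homLayeredABPComputes`,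
  `Σ_{j=1}^{d−1} str_j(F) ≤ #vertices` (the tree's vertex count includes source and sink, GGIL's "size"
  does not; the inequality is stated with the weaker right-hand side).  PROVED by the cut of the printed
  proof, exactly as in the tree's `kumar2019_thm_2_layered`.
* Calibration values from the tree (by name): `restrictedStrength_one_perPoly_succ` —
  `str_1(per_{n+1}) = sr(per_{n+1}) = n + 1` over any infinite field
  (`ChanIlten.le_of_perPoly_eq_sum_linear_mul` / `exists_perPoly_succ_eq_sum_linear_mul`, Chan–Ilten 2015);
  `restrictedStrength_one_detPoly_succ` — the same for `det` (Dieudonné / Lampert–Moshkovitz Thm 1);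
  `restrictedStrength_two_detPoly_four_le` — `str_2(det_4) ≤ 3` (Lampert–Moshkovitz Thm 3 / Cor 4,
  `LampertMoshkovitz.corollary4_upper`).
Proposition 9 (`sr(F) ≤ r` iff `Z(F)` contains a linear subspace of codimension `r`) is the subject of
the sibling file `GGIL22SliceRankSubspaces.lean`; Proposition 6 / Corollary 13 (singular-locus bound) is
in the tree problem-side (`…Theorems.PolyaContinuedLaplaceRigidity.Strength.height_singIdeal_le_of_eq_sum_mul`).

Consumer note: the `ValiantsHypothesis` line `laplace_rigidity` (stmt-17819) measures `per_n` by
`IsTwoFactorDecomp n k w p q`, and `∃ p q, IsTwoFactorDecomp n k w p q` is `HasRestrictedDecomp n k w (perPoly (Fin n) ℂ)`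
unfolded; its law `LaplaceRigidity` reads `∀ 0 < k < n, C(n,k) ≤ restrictedStrength n k (perPoly (Fin n) ℂ)`
(`le_restrictedStrength_iff`).  Honest
framing: vocabulary and the elementary §3.1 facts only; nothing here bears on `VP ≠ VNP` (NOT proved),
and no summit statement is proved in this file.

[cite: GesmundoGhosalIkenmeyerLysikov2022, Definition 5, Definition 8, Definition 10, Proposition 11,
Theorem 12]
-/

noncomputable section

namespace Literature.Computability.AlgebraicComplexity.GGIL22

open MvPolynomial Finset

variable {σ : Type*} {K : Type*}

/-! ### Definitions 5, 8, 10 -/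

section Defs

variable [CommSemiring K]

/-- **GGIL22 Definition 10 (the decompositions).**  `F` has a `j`-restricted (two-factor) strength
decomposition of width `r` in degree `d`: `F = Σ_{k<r} G_k H_k` with every `G_k` homogeneous of degree
`j` and every `H_k` homogeneous of degree `d − j`.
[cite: GesmundoGhosalIkenmeyerLysikov2022, Definition 10] -/
def HasRestrictedDecomp (d j r : ℕ) (F : MvPolynomial σ K) : Prop :=
  ∃ G H : Fin r → MvPolynomial σ K,
    (∀ k, (G k).IsHomogeneous j) ∧ (∀ k, (H k).IsHomogeneous (d - j)) ∧ F = ∑ k, G k * H k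

/-- **GGIL22 Definition 10: the `j`-restricted strength `str_j(F)`** of a form of degree `d` — the least
width of a `j`-restricted strength decomposition (`sInf`, `= 0` if there is none).
[cite: GesmundoGhosalIkenmeyerLysikov2022, Definition 10] -/
def restrictedStrength (d j : ℕ) (F : MvPolynomial σ K) : ℕ :=
  sInf {r | HasRestrictedDecomp d j r F}

/-- **GGIL22 Definition 8: the slice rank `sr(F)`** of a form of degree `d` — the least `r` with
`F = Σ_{k<r} L_k H_k`, `L_k` linear forms (and `H_k` forms of degree `d − 1`); by definition the
`1`-restricted strength (Proposition 11(c)).  Not the tensor slice rank of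
`Literature.Barriers.MatrixMultiplication.sliceRank`. [cite: GesmundoGhosalIkenmeyerLysikov2022, Definition 8] -/
def sliceRank (d : ℕ) (F : MvPolynomial σ K) : ℕ :=
  restrictedStrength d 1 F

/-- **GGIL22 Definition 5 (the decompositions).**  `F` has a strength decomposition of width `r` in
degree `d`: `F = Σ_{k<r} G_k H_k` with `G_k`, `H_k` homogeneous of (positive, complementary) degrees
`e_k, d − e_k < d`. [cite: GesmundoGhosalIkenmeyerLysikov2022, Definition 5] -/
def HasStrengthDecomp (d r : ℕ) (F : MvPolynomial σ K) : Prop :=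
  ∃ (G H : Fin r → MvPolynomial σ K) (e : Fin r → ℕ),
    (∀ k, 0 < e k ∧ e k < d) ∧ (∀ k, (G k).IsHomogeneous (e k)) ∧
      (∀ k, (H k).IsHomogeneous (d - e k)) ∧ F = ∑ k, G k * H k

/-- **GGIL22 Definition 5: the strength `str(F)`** of a form of degree `d`
("`min{r : F has a strength decomposition with r summands}`"; `sInf`, `= 0` if there is none).
[cite: GesmundoGhosalIkenmeyerLysikov2022, Definition 5] -/
def strength (d : ℕ) (F : MvPolynomial σ K) : ℕ :=
  sInf {r | HasStrengthDecomp d r F}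

end Defs

/-! ### Basic API: reindexing, monomial decompositions, attainment -/

section API

variable [CommSemiring K]

/-- A `j`-restricted decomposition indexed by any finite type gives one of width its cardinality.
[cite: GesmundoGhosalIkenmeyerLysikov2022, Definition 10] -/
theorem hasRestrictedDecomp_of_fintype {ι : Type*} [Fintype ι] {d j : ℕ} {F : MvPolynomial σ K}
    (G H : ι → MvPolynomial σ K) (hG : ∀ i, (G i).IsHomogeneous j)
    (hH : ∀ i, (H i).IsHomogeneous (d - j)) (hF : F = ∑ i, G i * H i) :
    HasRestrictedDecomp d j (Fintype.card ι) F := by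
  refine ⟨fun k => G ((Fintype.equivFin ι).symm k), fun k => H ((Fintype.equivFin ι).symm k),
    fun k => hG _, fun k => hH _, ?_⟩
  rw [hF]
  exact (Equiv.sum_comp (Fintype.equivFin ι).symm (fun i => G i * H i)).symm

/-- `str_j(F) ≤ r` for every `j`-restricted decomposition of width `r`.
[cite: GesmundoGhosalIkenmeyerLysikov2022, Definition 10] -/
theorem restrictedStrength_le {d j r : ℕ} {F : MvPolynomial σ K} (h : HasRestrictedDecomp d j r F) :
    restrictedStrength d j F ≤ r :=
  Nat.sInf_le h

/-- `str(F) ≤ r` for every strength decomposition of width `r`.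
[cite: GesmundoGhosalIkenmeyerLysikov2022, Definition 5] -/
theorem strength_le {d r : ℕ} {F : MvPolynomial σ K} (h : HasStrengthDecomp d r F) :
    strength d F ≤ r :=
  Nat.sInf_le h

/-- **Existence: the monomial decomposition.**  A form of degree `d ≥ j` is the sum, over its
support, of (a monomial of degree `j`) × (a monomial of degree `d − j`); hence it has a `j`-restricted
decomposition of width `#supp F`, and `str_j(F) ≤ #supp F`.
[cite: GesmundoGhosalIkenmeyerLysikov2022, Definition 10] -/
theorem hasRestrictedDecomp_card_support {d j : ℕ} {F : MvPolynomial σ K} (hF : F.IsHomogeneous d)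
    (hj : j ≤ d) : HasRestrictedDecomp d j F.support.card F := by
  classical
  -- split every monomial of the support
  have hsplit : ∀ m : F.support, ∃ m₁ : σ →₀ ℕ, m₁ ≤ (m : σ →₀ ℕ) ∧ m₁.degree = j := by
    intro m
    refine Finsupp.exists_le_degree_eq _ _ ?_
    have hm : ((m : σ →₀ ℕ)).degree = d := by
      rw [Finsupp.degree_eq_weight_one]
      exact hF (mem_support_iff.mp m.2)
    omega
  choose m₁ hm₁ hdeg using hsplit
  rw [← Fintype.card_coe]
  refine hasRestrictedDecomp_of_fintype (fun m : F.support => monomial (m₁ m) (1 : K))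
    (fun m : F.support => monomial ((m : σ →₀ ℕ) - m₁ m) (coeff m F))
    (fun m => isHomogeneous_monomial _ (hdeg m)) (fun m => isHomogeneous_monomial _ ?_) ?_
  · have hm : ((m : σ →₀ ℕ)).degree = d := by
      rw [Finsupp.degree_eq_weight_one]
      exact hF (mem_support_iff.mp m.2)
    have hsum : m₁ m + ((m : σ →₀ ℕ) - m₁ m) = m := add_tsub_cancel_of_le (hm₁ m)
    have := congrArg Finsupp.degree hsum
    rw [map_add, hdeg m, hm] at this
    omega
  · calc F = ∑ m ∈ F.support, monomial m (coeff m F) := (support_sum_monomial_coeff F).symm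
      _ = ∑ m : F.support, monomial (m : σ →₀ ℕ) (coeff m F) := (Finset.sum_coe_sort _ _).symm
      _ = ∑ m : F.support, monomial (m₁ m) (1 : K) * monomial ((m : σ →₀ ℕ) - m₁ m) (coeff m F) := by
          refine Finset.sum_congr rfl fun m _ => ?_
          rw [monomial_mul, one_mul, add_tsub_cancel_of_le (hm₁ m)]

/-- Hence `str_j(F) ≤ #supp F` for a form of degree `d ≥ j`.
[cite: GesmundoGhosalIkenmeyerLysikov2022, Definition 10] -/
theorem restrictedStrength_le_card_support {d j : ℕ} {F : MvPolynomial σ K} (hF : F.IsHomogeneous d)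
    (hj : j ≤ d) : restrictedStrength d j F ≤ F.support.card :=
  restrictedStrength_le (hasRestrictedDecomp_card_support hF hj)

/-- **Attainment:** a form of degree `d ≥ j` has a `j`-restricted decomposition of width exactly
`str_j(F)`. [cite: GesmundoGhosalIkenmeyerLysikov2022, Definition 10] -/
theorem exists_hasRestrictedDecomp_restrictedStrength {d j : ℕ} {F : MvPolynomial σ K}
    (hF : F.IsHomogeneous d) (hj : j ≤ d) : HasRestrictedDecomp d j (restrictedStrength d j F) F := by
  have h : ({r | HasRestrictedDecomp d j r F} : Set ℕ).Nonempty :=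
    ⟨_, hasRestrictedDecomp_card_support hF hj⟩
  exact Nat.sInf_mem h

/-- **The lower-bound form of `str_j`:** `w ≤ str_j(F)` iff every `j`-restricted decomposition has
width `≥ w` (for a form of degree `d ≥ j`). [cite: GesmundoGhosalIkenmeyerLysikov2022, Definition 10] -/
theorem le_restrictedStrength_iff {d j w : ℕ} {F : MvPolynomial σ K} (hF : F.IsHomogeneous d)
    (hj : j ≤ d) : w ≤ restrictedStrength d j F ↔ ∀ r, HasRestrictedDecomp d j r F → w ≤ r := by
  constructor
  · exact fun h r hr => h.trans (restrictedStrength_le hr)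
  · intro h
    exact le_csInf ⟨_, hasRestrictedDecomp_card_support hF hj⟩ fun r hr => h r hr

end API

/-! ### Homogenising the cofactors -/

section Homogenise

variable [CommSemiring K]

/-- `homogeneousComponent (i + j) (G * H) = G * homogeneousComponent j H` for `G` homogeneous of
degree `i`. [folklore] -/
private theorem homogeneousComponent_mul_left {i j : ℕ} {G : MvPolynomial σ K} (hG : G.IsHomogeneous i)
    (H : MvPolynomial σ K) : homogeneousComponent (i + j) (G * H) = G * homogeneousComponent j H := by
  classical
  conv_lhs => rw [← sum_homogeneousComponent H]
  rw [Finset.mul_sum, map_sum]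
  have hterm : ∀ n, homogeneousComponent (i + j) (G * homogeneousComponent n H) =
      if n = j then G * homogeneousComponent n H else 0 := by
    intro n
    rw [homogeneousComponent_of_mem (hG.mul (homogeneousComponent_isHomogeneous n H))]
    by_cases hn : n = j
    · simp [hn]
    · rw [if_neg (fun h => hn (Nat.add_left_cancel h).symm), if_neg hn]
  simp only [hterm]
  rw [Finset.sum_ite_eq' (Finset.range (H.totalDegree + 1)) j (fun n => G * homogeneousComponent n H)]
  split_ifs with hj
  · rfl
  · have hlt : H.totalDegree < j := by simpa using hj
    rw [homogeneousComponent_eq_zero _ _ hlt, mul_zero]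

/-- **Arbitrary cofactors may be homogenised.**  If a form `F` of degree `d` is written
`F = Σ_{k<r} G_k H_k` with `G_k` homogeneous of degree `j ≤ d` and ARBITRARY `H_k`, then replacing each
`H_k` by its homogeneous component of degree `d − j` gives a `j`-restricted decomposition of the same
width. [cite: GesmundoGhosalIkenmeyerLysikov2022, Definition 10 (with Definition 8)] -/
theorem hasRestrictedDecomp_of_eq_sum_mul {d j r : ℕ} {F : MvPolynomial σ K} (hF : F.IsHomogeneous d)
    (hj : j ≤ d) (G H : Fin r → MvPolynomial σ K) (hG : ∀ k, (G k).IsHomogeneous j)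
    (h : F = ∑ k, G k * H k) : HasRestrictedDecomp d j r F := by
  refine ⟨G, fun k => homogeneousComponent (d - j) (H k), hG,
    fun k => homogeneousComponent_isHomogeneous _ _, ?_⟩
  calc F = homogeneousComponent d F := (homogeneousComponent_eq_self hF).symm
    _ = ∑ k, homogeneousComponent (j + (d - j)) (G k * H k) := by
        rw [h, map_sum, Nat.add_sub_cancel' hj]
    _ = ∑ k, G k * homogeneousComponent (d - j) (H k) :=
        Finset.sum_congr rfl fun k _ => homogeneousComponent_mul_left (hG k) (H k)

/-- In particular `sr(F) ≤ r` whenever `F = Σ_{k<r} L_k H_k` with linear `L_k` and ARBITRARY `H_k`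
(`F` a form of degree `d ≥ 1`). [cite: GesmundoGhosalIkenmeyerLysikov2022, Definition 8] -/
theorem sliceRank_le_of_eq_sum_linear_mul {d r : ℕ} {F : MvPolynomial σ K} (hF : F.IsHomogeneous d)
    (hd : 1 ≤ d) (L H : Fin r → MvPolynomial σ K) (hL : ∀ k, (L k).IsHomogeneous 1)
    (h : F = ∑ k, L k * H k) : sliceRank d F ≤ r :=
  restrictedStrength_le (hasRestrictedDecomp_of_eq_sum_mul hF hd L H hL h)

end Homogenise

/-! ### Proposition 11 -/

section Prop11

variable [CommSemiring K]

/-- **Proposition 11(a), pointwise:** a `j`-restricted decomposition with `0 < j < d` is a strength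
decomposition, so `str(F) ≤ r`. [cite: GesmundoGhosalIkenmeyerLysikov2022, Proposition 11(a)] -/
theorem hasStrengthDecomp_of_hasRestrictedDecomp {d j r : ℕ} {F : MvPolynomial σ K} (hj : 0 < j)
    (hjd : j < d) (h : HasRestrictedDecomp d j r F) : HasStrengthDecomp d r F := by
  obtain ⟨G, H, hG, hH, hF⟩ := h
  exact ⟨G, H, fun _ => j, fun _ => ⟨hj, hjd⟩, hG, hH, hF⟩

/-- **GGIL22 Proposition 11(a): `str_j(F) ≥ str(F)`** for a form `F` of degree `d` and `1 ≤ j < d`.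
[cite: GesmundoGhosalIkenmeyerLysikov2022, Proposition 11(a)] -/
theorem strength_le_restrictedStrength {d j : ℕ} {F : MvPolynomial σ K} (hF : F.IsHomogeneous d)
    (hj : 0 < j) (hjd : j < d) : strength d F ≤ restrictedStrength d j F :=
  strength_le (hasStrengthDecomp_of_hasRestrictedDecomp hj hjd
    (exists_hasRestrictedDecomp_restrictedStrength hF hjd.le))

/-- Swapping the two factors: a `j`-restricted decomposition is a `(d − j)`-restricted one (`j ≤ d`).
[cite: GesmundoGhosalIkenmeyerLysikov2022, Proposition 11(b)] -/
theorem HasRestrictedDecomp.symm {d j r : ℕ} {F : MvPolynomial σ K} (hjd : j ≤ d)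
    (h : HasRestrictedDecomp d j r F) : HasRestrictedDecomp d (d - j) r F := by
  obtain ⟨G, H, hG, hH, hF⟩ := h
  refine ⟨H, G, hH, fun k => by rw [Nat.sub_sub_self hjd]; exact hG k, ?_⟩
  rw [hF]
  exact Finset.sum_congr rfl fun k _ => mul_comm _ _

/-- **GGIL22 Proposition 11(b): `str_j(F) = str_{d−j}(F)`** (`j ≤ d`).
[cite: GesmundoGhosalIkenmeyerLysikov2022, Proposition 11(b)] -/
theorem restrictedStrength_symm {d j : ℕ} (F : MvPolynomial σ K) (hjd : j ≤ d) :
    restrictedStrength d j F = restrictedStrength d (d - j) F := by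
  unfold restrictedStrength
  congr 1
  ext r
  exact ⟨fun h => h.symm hjd, fun h => by
    have h' := h.symm (Nat.sub_le d j)
    rwa [Nat.sub_sub_self hjd] at h'⟩

/-- **GGIL22 Proposition 11(c): `str_1(F) = sr(F)`** ("clear from the definition" — here literally the
definition of `sliceRank`). [cite: GesmundoGhosalIkenmeyerLysikov2022, Proposition 11(c)] -/
theorem sliceRank_eq_restrictedStrength_one (d : ℕ) (F : MvPolynomial σ K) :
    sliceRank d F = restrictedStrength d 1 F :=
  rfl

end Prop11

/-! ### Theorem 12: homogeneous ABPs and the sum of the restricted strengths -/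

section Thm12

variable {K : Type*} [Field K] {ι : Type*}

/-- **GGIL22 Theorem 12 (`B_hom(F) ≥ Σ_{j=1}^{d−1} str_j(F)`), layered homogeneous ABPs.**  If a NONZERO
form `F` of degree `d` is computed by a layered homogeneous ABP on `k` vertices
(`Kumar2019.HomLayeredABPComputes k F`: a layer function, every edge from a layer to the next and
labelled by a linear form, `F` = the `s → t` path sum), then `Σ_{j=1}^{d−1} str_j(F) ≤ k`: cutting at
the vertices `j` layers above the source writes `F = Σ_{v ∈ V_j} A[s,v] · A[v,t]` with `A[s,v]`
homogeneous of degree `j` and `A[v,t]` of degree `d − j` (a `j`-restricted decomposition of width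
`|V_j|`), and the classes `V_1, …, V_{d−1}` are disjoint.  (GGIL's "size" omits source and sink; the
tree's vertex count `k` includes them, so this is the printed bound with a weaker right-hand side.)
[cite: GesmundoGhosalIkenmeyerLysikov2022, Theorem 12] -/
theorem sum_restrictedStrength_le_of_homLayeredABPComputes {k d : ℕ} {F : MvPolynomial ι K}
    (hF : F.IsHomogeneous d) (hF0 : F ≠ 0) (h : Kumar2019.HomLayeredABPComputes k F) :
    ∑ j ∈ Finset.Icc 1 (d - 1), restrictedStrength d j F ≤ k := by
  classical
  obtain ⟨layer, s, t, N, hlay, hhom, hcomp⟩ := h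
  -- the path length is the degree `d`
  have hL : layer t - layer s = d :=
    (Kumar2019.pow_apply_isHomogeneous hhom _ s t).inj_right (hcomp ▸ hF) (by rwa [hcomp])
  rw [hL] at hcomp
  -- the vertices `i` layers above `s`
  let S : ℕ → Finset (Fin k) := fun i => Finset.univ.filter fun v => layer v = layer s + i
  -- the cut at layer `i` is an `i`-restricted decomposition of width `|S i|`
  have hclass : ∀ i, i ≤ d → restrictedStrength d i F ≤ (S i).card := by
    intro i hid
    have hsplit : F = ∑ v ∈ S i, (N ^ i) s v * (N ^ (d - i)) v t := by
      rw [← hcomp, show (N ^ d) s t = (N ^ (i + (d - i))) s t by rw [Nat.add_sub_cancel' hid],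
        pow_add, Matrix.mul_apply]
      refine (Finset.sum_subset (Finset.filter_subset _ _) fun v _ hv => ?_).symm
      have h0 : (N ^ i) s v = 0 := by
        by_contra hne
        exact hv (Finset.mem_filter.2 ⟨Finset.mem_univ _,
          Kumar2019.layer_eq_of_pow_apply_ne_zero hlay i s v hne⟩)
      rw [h0, zero_mul]
    rw [← Finset.sum_coe_sort] at hsplit
    have hdec := hasRestrictedDecomp_of_fintype (d := d) (j := i)
      (fun v : S i => (N ^ i) s v) (fun v : S i => (N ^ (d - i)) v t)
      (fun v => Kumar2019.pow_apply_isHomogeneous hhom _ _ _)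
      (fun v => Kumar2019.pow_apply_isHomogeneous hhom _ _ _) hsplit
    rw [Fintype.card_coe] at hdec
    exact restrictedStrength_le hdec
  -- the classes are disjoint subsets of the `k` vertices
  have hdisj : ∀ i ∈ Finset.Icc 1 (d - 1), ∀ j ∈ Finset.Icc 1 (d - 1), i ≠ j →
      Disjoint (S i) (S j) := by
    intro i _ j _ hij
    exact Finset.disjoint_filter.2 fun v _ hvi hvj => hij (by omega)
  have hcard : ∑ i ∈ Finset.Icc 1 (d - 1), (S i).card ≤ k := by
    rw [← Finset.card_biUnion hdisj]
    exact (Finset.card_le_univ _).trans (by rw [Fintype.card_fin])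
  exact (Finset.sum_le_sum fun i hi => hclass i (by
    have := (Finset.mem_Icc.1 hi).2; omega)).trans hcard

end Thm12

/-! ### Calibration values from the tree: `str_1(per_n) = str_1(det_n) = n`, `str_2(det_4) ≤ 3` -/

section Values

variable {K : Type*} [Field K]

/-- **`str_1(per_{n+1}) = sr(per_{n+1}) = n + 1`** over any infinite field: `≥` is Chan–Ilten 2015
Prop. 2.6 at `r = m = n` (tree: `ChanIlten.le_of_perPoly_eq_sum_linear_mul`), `≤` is the Laplace
expansion along a row (tree: `ChanIlten.exists_perPoly_succ_eq_sum_linear_mul`).  This is the case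
`k = 1` ("`PR₁(per_n) = n`") of rank laws on two-factor decompositions of the permanent.
[cite: GesmundoGhosalIkenmeyerLysikov2022, Definition 10 (with Proposition 9); ChanIlten2015, Proposition 2.6] -/
theorem restrictedStrength_one_perPoly_succ [Infinite K] (n : ℕ) :
    restrictedStrength (n + 1) 1 (perPoly (Fin (n + 1)) K) = n + 1 := by
  apply le_antisymm
  · obtain ⟨ℓ, q, hℓ, hq, h⟩ :=
      Literature.AlgebraicGeometry.DeterminantalHypersurfaces.ChanIlten.exists_perPoly_succ_eq_sum_linear_mul
        (K := K) n
    exact restrictedStrength_le ⟨ℓ, q, hℓ, by simpa using hq, h⟩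
  · have hper : (perPoly (Fin (n + 1)) K).IsHomogeneous (n + 1) := by
      simpa using perPoly_isHomogeneous (n := Fin (n + 1)) (k := K)
    rw [le_restrictedStrength_iff hper (by omega)]
    rintro r ⟨ℓ, q, hℓ, -, h⟩
    exact Literature.AlgebraicGeometry.DeterminantalHypersurfaces.ChanIlten.le_of_perPoly_eq_sum_linear_mul
      ℓ q hℓ h

/-- Hence also `sr(per_{n+1}) = n + 1`. [cite: GesmundoGhosalIkenmeyerLysikov2022, Definition 8] -/
theorem sliceRank_perPoly_succ [Infinite K] (n : ℕ) : sliceRank (n + 1) (perPoly (Fin (n + 1)) K) = n + 1 :=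
  restrictedStrength_one_perPoly_succ n

/-- **`str_1(det_{n+1}) = n + 1`** over any infinite field (Dieudonné; Lampert–Moshkovitz 2025 Thm 1:
tree `LampertMoshkovitz.theorem1_lower` / `theorem1_upper`).
[cite: GesmundoGhosalIkenmeyerLysikov2022, Definition 10; LampertMoshkovitz2025, Theorem 1] -/
theorem restrictedStrength_one_detPoly_succ [Infinite K] (n : ℕ) :
    restrictedStrength (n + 1) 1 (detPoly (Fin (n + 1)) K) = n + 1 := by
  apply le_antisymm
  · obtain ⟨ℓ, q, hℓ, hq, h⟩ := LampertMoshkovitz.theorem1_upper (R := K) n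
    exact restrictedStrength_le ⟨ℓ, q, hℓ, by simpa using hq, h⟩
  · have hdet : (detPoly (Fin (n + 1)) K).IsHomogeneous (n + 1) := by
      simpa using detPoly_isHomogeneous (n := Fin (n + 1)) (k := K)
    rw [le_restrictedStrength_iff hdet (by omega)]
    rintro r ⟨ℓ, q, hℓ, -, h⟩
    exact LampertMoshkovitz.theorem1_lower ℓ q hℓ h

/-- **`str_2(det_4) ≤ 3`** over any field (Lampert–Moshkovitz 2025, Thm 3 / Cor 4: the quadratic
expansion `det A = P₀₁P₂₃ − P₀₂P₁₃ + P₀₃P₁₂`; tree `LampertMoshkovitz.corollary4_upper`) — fewer than the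
`C(4,2) = 6` terms of the generalised Laplace expansion.
[cite: GesmundoGhosalIkenmeyerLysikov2022, Definition 10; LampertMoshkovitz2025, Corollary 4] -/
theorem restrictedStrength_two_detPoly_four_le : restrictedStrength 4 2 (detPoly (Fin 4) K) ≤ 3 := by
  obtain ⟨p, q, hp, hq, h⟩ := LampertMoshkovitz.corollary4_upper (R := K)
  exact restrictedStrength_le ⟨p, q, hp, hq, h⟩

end Values

end Literature.Computability.AlgebraicComplexity.GGIL22

end
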